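import Literature.Analysis.FluidPDE.NSBoundedMildOseen
import Literature.Analysis.FluidPDE.DistributionalToWeak
import Literature.Analysis.FluidPDE.PressureReconstruction
import HarnessLib

/-!
# Smooth mild solutions from a Gaussian-integrable datum are classical — discharge of (C)

Analysis/FluidPDE proofs file for the decomposition `NSBoundedMildOseen.lean` of the smoothing
fact `Literature.Analysis.FluidPDE.knss_classical_of_bounded_isBesovMildSolutionOn`
(Koch–Nadirashvili–Seregin–Šverák 2009, §4). It **discharges the named fact (C)**
`Literature.Analysis.FluidPDE.classical_of_smooth_isMildNSSolutionOn`
(`classical_of_smooth_isMildNSSolutionOn_holds`): a field `v` jointly `C^∞` on `(0, T) × E`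
with slices uniformly essentially bounded on every `(0, T₁)`, `T₁ < T`, which is a mild solution
on `(0, T)` in the duality form of Fabes–Jones–Rivière (tests `e^{ν(t-τ)Δ}φ`, `φ ∈ C_c^∞`
solenoidal) from a measurable datum `u₀` integrable against Gaussians, is a classical solution of
the unforced Navier–Stokes system on `(0, T)` for a smooth pressure.

## The proof

1. **Weak form on the open slab** (`integral_slab_eq_zero_of_isMildNSSolutionOn_datum`): exactly
   the argument of `ForwardMildWeak.lean` (the identity from the datum at `t ∈ (0, b]` tested
   with `Λ(t) = ∂ₜψ(t) + νΔψ(t)` and integrated in `t`, slab Fubini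
   `setIntegral_slab_duality_of_norm_le`, backward heat equation `𝒰[Λ] = -ψ`), with one change:
   the datum is not bounded but only integrable against every Gauss–Weierstrass kernel, so the
   free term `∫_{(0,b]} ⟨u₀, e^{νtΔ}Λ(t)⟩ dt = ⟨u₀, 𝒰[Λ](0)⟩ = -⟨u₀, ψ(0)⟩ = 0` is justified by
   the **Gaussian envelope** `‖e^{σΔ}Λ(t)(x)‖ ≤ K G_{2b₀}(x)` for `σ = ν t`, `t` in the time
   support `[a', b]` of `ψ`, `0 < a'` (`exists_norm_heatExtension_le_mul_heatKernel`: for `ψ`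
   bounded by `B` and supported in `B̄(0, R)`, `G_σ(y) ≤ (2b/a)^{d/2} e^{R²/(4a)} G_{2b}(x)` whenever
   `‖x - y‖ ≤ R` and `a ≤ σ ≤ b`), which makes `(t, x) ↦ ⟨u₀(x), e^{νtΔ}Λ(t)(x)⟩` integrable on
   the slab (`integral_integral_inner_heatTest_heatAdjointField_eq_zero_of_integrable_heatKernel`).
   The field is modified at the single time `0` (where the smooth `v` is arbitrary) to meet the
   closed-slab hypotheses of the slab lemmas; nothing at positive times changes.
2. **Localisation in time** (`integral_inner_momentum_eq_zero_of_slab_weak`): testing the weak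
   form with `ψ(t, x) = η(t)φ(x)`, `η ∈ C_c^∞((0, T))`, `φ` solenoidal, gives
   `∫ (η' G + η H) dt = 0`, `G = ⟨v, φ⟩`, `H = ⟨v, (v·∇)φ⟩ + ν⟨v, Δφ⟩`; the fibrewise integration
   by parts `∫ (η'⟨v, φ⟩ + η⟨∂ₜv, φ⟩) dt = 0` (`integral_deriv_mul_inner_add_eq_zero`, the
   derivative of the compactly supported `η⟨v, φ⟩`) integrated in `x` gives
   `∫ (η' G + η G₁) dt = 0`, `G₁ = ⟨∂ₜv, φ⟩`; hence `∫ η (H - G₁) = 0` for all `η`, so `H = G₁`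
   on `(0, T)` (du Bois-Reymond, Mathlib `IsOpen.ae_eq_zero_of_integral_contDiff_smul_eq_zero`,
   and continuity); integrating by parts in `x` (`integral_inner_convect_add_eq_zero`, `div v = 0`,
   `integral_inner_laplacian_comm`) yields `∫ ⟪∂ₜv + (v·∇)v - νΔv, φ⟫ = 0`.
3. **Pressure** by `exists_isClassicalNSSolutionOn_of_forall_integral_inner_eq_zero`
   (`PressureReconstruction.lean`); `div v(t) = 0` classically from the weak divergence
   constraint of the mild class and smoothness (`IsWeaklyDivFree.isDivFree_of_contDiff`).

## References

* E. B. Fabes, B. F. Jones, N. M. Rivière, *The initial value problem for the Navier–Stokes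
  equations with data in `L^p`*, Arch. Rational Mech. Anal. 45 (1972) 222–240, Thm. 2.1 (the
  duality form and its equivalence with the equations for regular fields). [FabesJonesRiviere1972]
* G. Koch, N. Nadirashvili, G. Seregin, V. Šverák, Acta Math. 203 (2009) 83–105 =
  arXiv:0709.3599, §4 (i)–(ii) p. 8 (mild and weak solutions in `L^∞_{x,t}`).
  [KochNadirashviliSereginSverak2009]
* L. C. Evans, *Partial Differential Equations*, 2nd ed., AMS 2010, §2.3.1 (heat kernel).
  [Evans2010]
-/

noncomputable section

open MeasureTheory Set Function Filter TopologicalSpace InnerProductSpace Metric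
open _root_.Topology
open scoped RealInnerProductSpace NNReal ENNReal Laplacian

namespace Literature.Analysis.FluidPDE

variable {E : Type*} [NormedAddCommGroup E] [InnerProductSpace ℝ E] [FiniteDimensional ℝ E]
  [MeasurableSpace E] [BorelSpace E]
variable {F : Type*} [NormedAddCommGroup F] [NormedSpace ℝ F]

/-! ### The Gaussian envelope of caloric extensions of compactly supported bounded fields -/

section Envelope

open Real

omit [FiniteDimensional ℝ E] [MeasurableSpace E] [BorelSpace E] in
/-- **Pointwise Gaussian comparison**: for `0 < a ≤ σ ≤ b` and `‖x - y‖ ≤ R`,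
`G_σ(y) ≤ (4πa)^{-d/2} e^{R²/(4a)} (8πb)^{d/2} · G_{2b}(x)` (from `‖x‖² ≤ 2‖y‖² + 2R²`, so
`-‖y‖²/(4σ) ≤ R²/(4a) - ‖x‖²/(8b)`, and `(4πσ)^{-d/2} ≤ (4πa)^{-d/2}`). Evans, *PDE*, §2.3.1 (the
kernel). [folklore] -/
theorem heatKernel_le_mul_heatKernel_of_norm_sub_le {a b σ R : ℝ} (ha : 0 < a) (haσ : a ≤ σ)
    (hσb : σ ≤ b) {x y : E} (hxy : ‖x - y‖ ≤ R) :
    UnboundedOperators.heatKernel σ y ≤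
      ((4 * π * a) ^ (-(Module.finrank ℝ E : ℝ) / 2) * Real.exp (R ^ 2 / (4 * a)) *
        (4 * π * (2 * b)) ^ ((Module.finrank ℝ E : ℝ) / 2)) *
        UnboundedOperators.heatKernel (2 * b) x := by
  have hσ : 0 < σ := ha.trans_le haσ
  have hb : 0 < b := hσ.trans_le hσb
  set d : ℝ := (Module.finrank ℝ E : ℝ) with hd
  have hd0 : 0 ≤ d := by positivity
  -- `‖x‖² ≤ 2‖y‖² + 2R²`
  have hR : 0 ≤ R := (norm_nonneg _).trans hxy
  have h1 : ‖x‖ ≤ ‖y‖ + R := (norm_le_insert' x y).trans (by linarith)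
  have h2 : ‖x‖ ^ 2 ≤ 2 * ‖y‖ ^ 2 + 2 * R ^ 2 := by
    nlinarith [norm_nonneg x, norm_nonneg y, sq_nonneg (‖y‖ - R)]
  -- the exponent
  have e1 : -‖y‖ ^ 2 / (4 * σ) ≤ -(‖x‖ ^ 2 / 2 - R ^ 2) / (4 * σ) :=
    div_le_div_of_nonneg_right (by linarith) (by positivity)
  have e2 : R ^ 2 / (4 * σ) ≤ R ^ 2 / (4 * a) :=
    div_le_div_of_nonneg_left (sq_nonneg R) (by positivity) (by linarith)
  have e3 : ‖x‖ ^ 2 / (8 * b) ≤ ‖x‖ ^ 2 / (8 * σ) :=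
    div_le_div_of_nonneg_left (sq_nonneg _) (by positivity) (by linarith)
  have e4 : -‖y‖ ^ 2 / (4 * σ) ≤ R ^ 2 / (4 * a) + -‖x‖ ^ 2 / (4 * (2 * b)) := by
    have : -(‖x‖ ^ 2 / 2 - R ^ 2) / (4 * σ) = R ^ 2 / (4 * σ) - ‖x‖ ^ 2 / (8 * σ) := by ring
    have : -‖x‖ ^ 2 / (4 * (2 * b)) = -(‖x‖ ^ 2 / (8 * b)) := by ring
    linarith
  have hE : Real.exp (-‖y‖ ^ 2 / (4 * σ)) ≤
      Real.exp (R ^ 2 / (4 * a)) * Real.exp (-‖x‖ ^ 2 / (4 * (2 * b))) := by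
    rw [← Real.exp_add]
    exact Real.exp_le_exp.2 e4
  -- the prefactor
  have hA : (4 * π * σ) ^ (-d / 2) ≤ (4 * π * a) ^ (-d / 2) :=
    Real.rpow_le_rpow_of_nonpos (by positivity) (by nlinarith [Real.pi_pos]) (by linarith)
  have hC : (4 * π * (2 * b)) ^ (d / 2) * (4 * π * (2 * b)) ^ (-d / 2) = 1 := by
    rw [neg_div, Real.rpow_neg (by positivity), mul_inv_cancel₀]
    exact (Real.rpow_pos_of_pos (by positivity) _).ne'
  calc UnboundedOperators.heatKernel σ y
      = (4 * π * σ) ^ (-d / 2) * Real.exp (-‖y‖ ^ 2 / (4 * σ)) := rfl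
    _ ≤ (4 * π * a) ^ (-d / 2) * (Real.exp (R ^ 2 / (4 * a)) * Real.exp (-‖x‖ ^ 2 / (4 * (2 * b)))) :=
        mul_le_mul hA hE (Real.exp_pos _).le (Real.rpow_nonneg (by positivity) _)
    _ = (4 * π * a) ^ (-d / 2) * Real.exp (R ^ 2 / (4 * a)) *
          ((4 * π * (2 * b)) ^ (d / 2) * (4 * π * (2 * b)) ^ (-d / 2)) *
          Real.exp (-‖x‖ ^ 2 / (4 * (2 * b))) := by rw [hC]; ring
    _ = _ := by
        simp only [UnboundedOperators.heatKernel, hd]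
        ring


/-- **Gaussian envelope of the caloric extension of bounded compactly supported fields**: for
`0 < a ≤ b` and `R`, `B` there is `K ≥ 0` (namely
`(4πa)^{-d/2} e^{R²/(4a)} (8πb)^{d/2} · B · |B̄(0,R)|`) such that every `ψ` bounded by `B` and
vanishing off `B̄(0, R)` satisfies `‖e^{σΔ}ψ (x)‖ ≤ K G_{2b}(x)` for all `σ ∈ [a, b]` and all `x`
(`e^{σΔ}ψ(x) = ∫ G_σ(y) ψ(x - y) dy`, the integrand living on `‖x - y‖ ≤ R`, where
`heatKernel_le_mul_heatKernel_of_norm_sub_le` applies). Evans, *PDE*, §2.3.1. [folklore] -/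
theorem exists_norm_heatExtension_le_mul_heatKernel {a b : ℝ} (ha : 0 < a) (hab : a ≤ b)
    (R B : ℝ) :
    ∃ K : ℝ, 0 ≤ K ∧ ∀ ψ : E → F, (∀ z, ‖ψ z‖ ≤ B) → (∀ z, R < ‖z‖ → ψ z = 0) →
      ∀ σ ∈ Icc a b, ∀ x, ‖UnboundedOperators.heatExtension ψ σ x‖ ≤
        K * UnboundedOperators.heatKernel (2 * b) x := by
  have hb : 0 < b := ha.trans_le hab
  set K₀ : ℝ := (4 * π * a) ^ (-(Module.finrank ℝ E : ℝ) / 2) * Real.exp (R ^ 2 / (4 * a)) *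
    (4 * π * (2 * b)) ^ ((Module.finrank ℝ E : ℝ) / 2) with hK₀
  have hK₀0 : 0 ≤ K₀ := by rw [hK₀]; positivity
  refine ⟨K₀ * max B 0 * (volume : Measure E).real (closedBall (0 : E) R), by positivity,
    fun ψ hB hR σ hσ x => ?_⟩
  have hσ0 : 0 < σ := ha.trans_le hσ.1
  set c : ℝ := K₀ * UnboundedOperators.heatKernel (2 * b) x * max B 0 with hc
  have hGx := (UnboundedOperators.heatKernel_pos (by positivity : (0:ℝ) < 2 * b) x).le
  have hc0 : 0 ≤ c := by positivity
  rw [UnboundedOperators.heatExtension_apply]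
  have hg : Integrable ((closedBall x R).indicator fun _ => c) (volume : Measure E) :=
    (integrableOn_const measure_closedBall_lt_top.ne).integrable_indicator measurableSet_closedBall
  have hle : ∀ᵐ y ∂(volume : Measure E),
      ‖UnboundedOperators.heatKernel σ y • ψ (x - y)‖ ≤ (closedBall x R).indicator (fun _ => c) y := by
    refine Eventually.of_forall fun y => ?_
    by_cases hy : y ∈ closedBall x R
    · rw [indicator_of_mem hy, norm_smul, Real.norm_of_nonneg (UnboundedOperators.heatKernel_pos hσ0 y).le]
      have hxy : ‖x - y‖ ≤ R := by rwa [mem_closedBall, dist_eq_norm, norm_sub_rev] at hy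
      calc UnboundedOperators.heatKernel σ y * ‖ψ (x - y)‖
          ≤ (K₀ * UnboundedOperators.heatKernel (2 * b) x) * max B 0 :=
            mul_le_mul (heatKernel_le_mul_heatKernel_of_norm_sub_le ha hσ.1 hσ.2 hxy)
              ((hB _).trans (le_max_left _ _)) (norm_nonneg _) (by positivity)
        _ = c := by rw [hc]
    · rw [indicator_of_notMem hy]
      have hxy : R < ‖x - y‖ := by
        rw [mem_closedBall, dist_eq_norm, norm_sub_rev, not_le] at hy
        exact hy
      rw [hR _ hxy, smul_zero, norm_zero]
  calc ‖∫ y, UnboundedOperators.heatKernel σ y • ψ (x - y)‖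
      ≤ ∫ y, (closedBall x R).indicator (fun _ => c) y := norm_integral_le_of_norm_le hg hle
    _ = (volume : Measure E).real (closedBall x R) * c := by
        rw [integral_indicator_const _ measurableSet_closedBall, smul_eq_mul]
    _ = (volume : Measure E).real (closedBall (0 : E) R) * c := by
        rw [measureReal_def, measureReal_def, Measure.addHaar_closedBall_center]
    _ = _ := by rw [hc]; ring

end Envelope

/-! ### The free caloric term for a Gaussian-integrable datum -/

section FreeTerm

omit [FiniteDimensional ℝ E] [MeasurableSpace E] [BorelSpace E] in
/-- **Uniform spatial support radius of a space–time test field**: there is `R ≥ 0` with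
`ψ(t, z) = 0` whenever `‖z‖ > R` (the projection of the compact support to `E` is bounded). [folklore] -/
theorem IsSpaceTimeTestOn.exists_forall_eq_zero_of_lt_norm {ψ : ℝ → E → F}
    (hψ : IsSpaceTimeTestOn (⊤ : Opens (ℝ × E)) ψ) :
    ∃ R : ℝ, 0 ≤ R ∧ ∀ t z, R < ‖z‖ → ψ t z = 0 := by
  obtain ⟨K, hK, hsub⟩ := hψ.exists_compact_slice_subset
  obtain ⟨R, hR⟩ := hK.isBounded.subset_closedBall (0 : E)
  refine ⟨max R 0, le_max_right _ _, fun t z hz => ?_⟩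
  have hz' : z ∉ tsupport (ψ t) := fun h => by
    have := hR (hsub t h)
    rw [mem_closedBall, dist_zero_right] at this
    linarith [le_max_left R 0]
  exact image_eq_zero_of_notMem_tsupport hz'

variable {ν : ℝ}

/-- **The free (caloric) term integrates to zero in time — Gaussian-integrable datum.** Twin of
`integral_integral_inner_heatTest_heatAdjointField_eq_zero` (`AncientMildWeak.lean`) for a datum
`w` which is merely measurable and integrable against every Gauss–Weierstrass kernel
(`∫ G_c ‖w‖ < ∞`, all `c > 0`) instead of bounded: for a space–time test field `ψ` with time
support in `[a', b']`, `a < a'`, `b' ≤ b`,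
`∫_{(a,b]} ⟨w, e^{ν(t-a)Δ} Λ_ν ψ(t)⟩ dt = ⟨w, 𝒰[Λ_ν ψ](a)⟩ = -⟨w, ψ(a)⟩ = 0`, `Λ_ν ψ = ∂ₜψ + νΔψ`.
The slab integrability of `(t, x) ↦ ⟨w(x), e^{ν(t-a)Δ}Λ(t)(x)⟩` comes from the Gaussian envelope
`‖e^{ν(t-a)Δ}Λ(t)(x)‖ ≤ K G_{2b₀}(x)` on the time support (`exists_norm_heatExtension_le_mul_heatKernel`,
with `a₀ = ν(a' - a) > 0`); the rest of the proof (Fubini, the substitution `t = a + σ`, and the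
backward heat equation `𝒰[∂ₜψ + νΔψ] = -ψ`) is word for word that of the bounded twin
(Fabes–Jones–Rivière 1972, §2). [folklore] -/
theorem integral_integral_inner_heatTest_heatAdjointField_eq_zero_of_integrable_heatKernel
    (hν : 0 < ν) {w : E → E} (hw : AEStronglyMeasurable w volume)
    (hwG : ∀ c : ℝ, 0 < c → Integrable (fun x => UnboundedOperators.heatKernel c x * ‖w x‖) volume)
    {ψ : ℝ → E → E} (hψ : IsSpaceTimeTestOn (⊤ : Opens (ℝ × E)) ψ)
    {a' b' a b : ℝ} (hsupp : ∀ t, t ∉ Icc a' b' → ψ t = 0) (haa' : a < a') (hab : a ≤ b)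
    (hb'b : b' ≤ b) :
    ∫ t in Ioc a b, ∫ x, ⟪w x, heatTest ν (fun y => timeDeriv ψ t y + ν • Δ (ψ t) y) (t - a) x⟫ = 0 := by
  set Λ : ℝ → E → E := fun t y => timeDeriv ψ t y + ν • Δ (ψ t) y with hΛ_def
  have hΛ : IsSpaceTimeTestOn (⊤ : Opens (ℝ × E)) Λ := hψ.heatAdjointField_top ν
  have hΛsupp : ∀ t, t ∉ Icc a' b' → Λ t = 0 := fun t ht =>
    heatAdjointField_eq_zero_of_time_support hsupp ν ht
  have hψa : ψ a = 0 := hsupp a fun h => by linarith [h.1]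
  obtain ⟨C, hC0, hC⟩ := hΛ.exists_norm_le
  obtain ⟨R, hR0, hR⟩ := hΛ.exists_forall_eq_zero_of_lt_norm
  -- the heat part `G(t, x) = e^{ν(t-a)Δ} Λ(t)(x)` written with the caloric extension
  set G : ℝ × E → E := fun q =>
    UnboundedOperators.heatExtension (Λ (a + (q.1 - a))) (ν * (q.1 - a)) q.2 with hG_def
  have hH : ∀ t, a < t → ∀ x, heatTest ν (Λ t) (t - a) x = G (t, x) := by
    intro t ht x
    simp only [hG_def, add_sub_cancel]
    rw [heatTest_of_pos hν (sub_pos.2 ht)]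
  have hcont : ContinuousOn G {q : ℝ × E | a < q.1} := by
    have hc2 : Continuous fun q : ℝ × E => ((a, q.1 - a, q.2) : ℝ × ℝ × E) := by fun_prop
    have h := ContinuousOn.comp (g := fun p : ℝ × ℝ × E =>
        UnboundedOperators.heatExtension (Λ (p.1 + p.2.1)) (ν * p.2.1) p.2.2)
      (f := fun q : ℝ × E => ((a, q.1 - a, q.2) : ℝ × ℝ × E)) (s := {q : ℝ × E | a < q.1})
      (hΛ.continuousOn_duhamelIntegrand hν) hc2.continuousOn
      (fun q hq => show (0 : ℝ) < q.1 - a from sub_pos.2 hq)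
    simpa only [Function.comp_def] using h
  -- the Gaussian envelope of `G` on the slab: `‖G(t, x)‖ ≤ K₁ G_{2b₀}(x)` for `t ∈ (a, b]`
  set a₀ : ℝ := ν * (a' - a) with ha₀
  have ha₀pos : 0 < a₀ := mul_pos hν (by linarith)
  set b₀ : ℝ := ν * (b - a) + a₀ with hb₀
  have hb₀pos : 0 < b₀ := add_pos_of_nonneg_of_pos (mul_nonneg hν.le (by linarith)) ha₀pos
  have ha₀b₀ : a₀ ≤ b₀ := le_add_of_nonneg_left (mul_nonneg hν.le (by linarith))
  obtain ⟨K₁, hK₁0, hK₁⟩ := exists_norm_heatExtension_le_mul_heatKernel (E := E) (F := E)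
    ha₀pos ha₀b₀ R C
  have hGenv : ∀ t ∈ Ioc a b, ∀ x, ‖G (t, x)‖ ≤ K₁ * UnboundedOperators.heatKernel (2 * b₀) x := by
    intro t ht x
    by_cases htI : t ∈ Icc a' b'
    · have h1 : a₀ ≤ ν * (t - a) := mul_le_mul_of_nonneg_left (by linarith [htI.1]) hν.le
      have h2 : ν * (t - a) ≤ b₀ := by
        have : ν * (t - a) ≤ ν * (b - a) := mul_le_mul_of_nonneg_left (by linarith [ht.2]) hν.le
        linarith
      have h := hK₁ (Λ (a + (t - a))) (fun z => hC _ z) (fun z hz => hR _ z hz) (ν * (t - a))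
        ⟨h1, h2⟩ x
      simpa only [hG_def] using h
    · have hz : Λ (a + (t - a)) = 0 := by rw [add_sub_cancel]; exact hΛsupp t htI
      have : G (t, x) = 0 := by
        simp only [hG_def, hz]
        rw [UnboundedOperators.heatExtension_apply]
        simp
      rw [this, norm_zero]
      exact mul_nonneg hK₁0 (UnboundedOperators.heatKernel_pos (by positivity) x).le
  -- the pairing `F(t, x) = ⟪w x, G(t, x)⟫` is integrable on the slab `(a, b] × E`
  set μ : Measure ℝ := volume.restrict (Ioc a b) with hμ
  haveI : IsFiniteMeasure μ := by rw [hμ]; exact isFiniteMeasure_restrict.2 measure_Ioc_lt_top.ne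
  have hGm : AEStronglyMeasurable G (μ.prod (volume : Measure E)) := by
    have hS : MeasurableSet {q : ℝ × E | a < q.1} := measurableSet_lt measurable_const measurable_fst
    have h1 : AEStronglyMeasurable G ((volume : Measure (ℝ × E)).restrict {q : ℝ × E | a < q.1}) :=
      hcont.aestronglyMeasurable hS
    rw [hμ, ← volume_restrict_prod_univ_eq_prod]
    refine h1.mono_measure (Measure.restrict_mono (fun q hq => ?_) le_rfl)
    exact (mem_prod.1 hq).1.1
  have hFm : AEStronglyMeasurable (fun q : ℝ × E => ⟪w q.2, G q⟫) (μ.prod (volume : Measure E)) :=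
    (hw.comp_snd).inner hGm
  have hmaj : Integrable
      (fun q : ℝ × E => K₁ * (UnboundedOperators.heatKernel (2 * b₀) q.2 * ‖w q.2‖))
      (μ.prod (volume : Measure E)) :=
    ((hwG (2 * b₀) (by positivity)).const_mul K₁).comp_snd μ
  have hIoc : ∀ᵐ q ∂(μ.prod (volume : Measure E)), q.1 ∈ Ioc a b := by
    rw [hμ]
    exact (Measure.quasiMeasurePreserving_fst (μ := volume.restrict (Ioc a b))
      (ν := (volume : Measure E))).ae (ae_restrict_mem measurableSet_Ioc)
  have hF : Integrable (fun q : ℝ × E => ⟪w q.2, G q⟫) (μ.prod (volume : Measure E)) := by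
    refine hmaj.mono' hFm ?_
    filter_upwards [hIoc] with q hq
    calc ‖⟪w q.2, G q⟫‖ ≤ ‖w q.2‖ * ‖G q‖ := norm_inner_le_norm _ _
      _ ≤ ‖w q.2‖ * (K₁ * UnboundedOperators.heatKernel (2 * b₀) q.2) :=
          mul_le_mul_of_nonneg_left (hGenv q.1 hq q.2) (norm_nonneg _)
      _ = K₁ * (UnboundedOperators.heatKernel (2 * b₀) q.2 * ‖w q.2‖) := by ring
  -- replace `heatTest` by `G` and swap the integrals
  have e1 : ∫ t in Ioc a b, ∫ x, ⟪w x, heatTest ν (Λ t) (t - a) x⟫ =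
      ∫ t in Ioc a b, ∫ x, ⟪w x, G (t, x)⟫ := by
    refine setIntegral_congr_fun measurableSet_Ioc fun t ht => ?_
    refine integral_congr_ae (Eventually.of_forall fun x => ?_)
    show ⟪w x, heatTest ν (Λ t) (t - a) x⟫ = ⟪w x, G (t, x)⟫
    rw [hH t ht.1 x]
  rw [e1]
  have hF' : Integrable (uncurry fun (t : ℝ) (x : E) => ⟪w x, G (t, x)⟫)
      (μ.prod (volume : Measure E)) := hF
  rw [integral_integral_swap hF']
  -- the time integral of `G(·, x)` is `𝒰[Λ](a)(x) = -ψ(a)(x) = 0`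
  have hGt : ∀ x, IntegrableOn (fun t => G (t, x)) (Ioc a b) volume ∧
      ∫ t in Ioc a b, G (t, x) = heatDuhamelBack ν Λ a x := by
    intro x
    have hS : MeasurableSet (Ioi a) := measurableSet_Ioi
    have hc2 : Continuous fun t : ℝ => ((t, x) : ℝ × E) := by fun_prop
    have hct : ContinuousOn (fun t => G (t, x)) (Ioi a) := by
      have h := ContinuousOn.comp (s := Ioi a) hcont hc2.continuousOn
        (fun t (ht : t ∈ Ioi a) => show ((t, x) : ℝ × E) ∈ {q : ℝ × E | a < q.1} from ht)
      simpa only [Function.comp_def] using h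
    have hmt : AEStronglyMeasurable (fun t => G (t, x)) (volume.restrict (Ioc a b)) :=
      (hct.aestronglyMeasurable hS).mono_measure (Measure.restrict_mono Ioc_subset_Ioi_self le_rfl)
    have hint : IntegrableOn (fun t => G (t, x)) (Ioc a b) volume := by
      refine Integrable.mono' (integrable_const C) hmt ?_
      refine (ae_restrict_iff' measurableSet_Ioc).2 (Eventually.of_forall fun t ht => ?_)
      exact UnboundedOperators.norm_heatExtension_le (hC _) (mul_pos hν (sub_pos.2 ht.1)) x
    refine ⟨hint, ?_⟩
    rw [hΛ.heatDuhamelBack_eq_setIntegral_Ioc hν hΛsupp (s := a) (L := b - a) (sub_nonneg.2 hab)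
      (by linarith) x, ← intervalIntegral.integral_of_le hab,
      ← intervalIntegral.integral_of_le (sub_nonneg.2 hab)]
    have h := intervalIntegral.integral_comp_sub_right (a := a) (b := b)
      (fun σ => UnboundedOperators.heatExtension (Λ (a + σ)) (ν * σ) x) a
    rw [sub_self] at h
    rw [← h]
  have e3 : ∀ x, ∫ t in Ioc a b, ⟪w x, G (t, x)⟫ = 0 := fun x => by
    obtain ⟨hint, hval⟩ := hGt x
    rw [integral_inner hint, hval]
    have h0 : heatDuhamelBack ν Λ a x = 0 := by
      rw [hΛ_def, hψ.heatDuhamelBack_heatAdjointField hν a x, hψa]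
      simp
    rw [h0, inner_zero_right]
  simp_rw [hμ] at e3 ⊢
  simp [e3]


variable {u : ℝ → E → E}

/-- **The tested identity from the datum as a slab integral** (the identity is the hypothesis;
twin of `integral_inner_sub_eq_slab_of_isMildNSSolutionBetween` of `ForwardMildWeak.lean` for the
identity *from a datum* `u₀`, `Fluid.IsMildNSSolutionFrom ν 0 u₀ u t`, base time `0`). Let `u` be
bounded by `M` with measurable slices on `[0, b]` and jointly measurable on `(0, b] × E`, `Θ` a
space–time test field with divergence-free slices, `0 < ν`, `t ∈ (0, b]`. Then
`∫⟪u(t), Θ(t)⟫ - ∫⟪u₀, e^{νtΔ}Θ(t)⟫` is the integral over the slab `(0, b] × E` of the transport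
integrand `⟪u, K_t u⟫`, `K_t(τ, x) = 1_{τ<t} D(e^{ν(t-τ)Δ}Θ(t))(x)` (Fubini on the slab). [folklore] -/
theorem integral_inner_sub_eq_slab_of_isMildNSSolutionFrom (hν : 0 < ν) {b : ℝ} (hb : 0 ≤ b)
    {M : ℝ} (hM : ∀ τ ∈ Icc 0 b, ∀ x, ‖u τ x‖ ≤ M)
    (hsl : ∀ τ ∈ Icc 0 b, AEStronglyMeasurable (u τ) volume)
    (hmeas : AEStronglyMeasurable (uncurry u) ((volume.restrict (Ioc 0 b)).prod (volume : Measure E)))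
    {u₀ : E → E} {Θ : ℝ → E → E} (hΘ : IsSpaceTimeTestOn (⊤ : Opens (ℝ × E)) Θ)
    (hΘd : ∀ t, VectorCalculus.IsDivFree (Θ t)) {t : ℝ} (ht : t ∈ Ioc 0 b)
    (hid : IsMildNSSolutionFrom ν 0 u₀ u t) :
    (∫ x, ⟪u t x, Θ t x⟫) - ∫ x, ⟪u₀ x, heatTest ν (Θ t) t x⟫ =
      ∫ y, ⟪u y.1 y.2, (if y.1 < t then fderiv ℝ (heatTest ν (Θ t) (t - y.1)) y.2 else 0) (u y.1 y.2)⟫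
        ∂((volume.restrict (Ioc 0 b)).prod (volume : Measure E)) := by
  have key := hid (Θ t) (hΘ.isTestFunctionOn_slice t) (hΘd t)
  have hzero : (∫ τ in (0 : ℝ)..t, ∫ x, ⟪(0 : ℝ → E → E) τ x, heatTest ν (Θ t) (t - τ) x⟫) = 0 := by
    simp
  rw [hzero, add_zero] at key
  rw [key, add_sub_cancel_left, intervalIntegral.integral_of_le ht.1.le]
  -- the slab integral, by Fubini
  obtain ⟨R, -, hK1⟩ := hΘ.exists_integral_norm_transportKernel_le hν
  have hslab := integrable_transportIntegrand_slab_of_norm_le (a := u)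
    (K := fun (t' : ℝ) (y : ℝ × E) => if y.1 < t' then fderiv ℝ (heatTest ν (Θ t') (t' - y.1)) y.2 else 0)
    (t := t) hb hK1 (hΘ.aestronglyMeasurable_transportKernel_slice hν t _) hmeas hsl hM
  rw [integral_prod _ hslab.1]
  dsimp only
  have hvan : ∀ τ, ¬ τ < t → (∫ x, ⟪u τ x,
      (if τ < t then fderiv ℝ (heatTest ν (Θ t) (t - τ)) x else 0) (u τ x)⟫) = 0 := by
    intro τ hτt
    simp [if_neg hτt]
  have e2 : (∫ τ in Ioc 0 b, ∫ x, ⟪u τ x,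
      (if τ < t then fderiv ℝ (heatTest ν (Θ t) (t - τ)) x else 0) (u τ x)⟫) =
      ∫ τ in Ioc 0 t, ∫ x, ⟪u τ x,
        (if τ < t then fderiv ℝ (heatTest ν (Θ t) (t - τ)) x else 0) (u τ x)⟫ := by
    have hind : EqOn (fun τ => ∫ x, ⟪u τ x,
        (if τ < t then fderiv ℝ (heatTest ν (Θ t) (t - τ)) x else 0) (u τ x)⟫)
        ((Iic t).indicator fun τ => ∫ x, ⟪u τ x,
          (if τ < t then fderiv ℝ (heatTest ν (Θ t) (t - τ)) x else 0) (u τ x)⟫)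
        (Ioc 0 b) := fun τ _ => by
      by_cases h : τ ≤ t
      · rw [indicator_of_mem (show τ ∈ Iic t from h)]
      · rw [indicator_of_notMem (show τ ∉ Iic t from h)]
        exact hvan τ fun hlt => h hlt.le
    rw [setIntegral_congr_fun measurableSet_Ioc hind, setIntegral_indicator measurableSet_Iic,
      Ioc_inter_Iic, inf_of_le_right ht.2]
  rw [e2]
  refine setIntegral_congr_ae measurableSet_Ioc ?_
  filter_upwards [measure_eq_zero_iff_ae_notMem.1 (measure_singleton t)] with τ hτt hτ'
  have hlt : τ < t := lt_of_le_of_ne hτ'.2 hτt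
  simp only [if_pos hlt, convect_apply]

/-- **Bounded mild solutions from a Gaussian-integrable datum satisfy the space–time weak
identity on the open slab** (Koch–Nadirashvili–Seregin–Šverák 2009, §4 (i)–(ii), arXiv p. 8: mild
solutions in `L^∞_{x,t}` are weak solutions; Fabes–Jones–Rivière 1972, Thm. 2.1 (ii) ⇒ (i) for
the duality formulation; the bounded-datum form is
`isBoundedWeakNSSolutionOn_of_isMildNSSolutionOn`, `ForwardMildWeak.lean`). Let `0 < ν`,
`0 < T`, let `u₀` be measurable and integrable against every Gauss–Weierstrass kernel, and let
`u` be a mild solution on `(0, T)` in the duality form from the datum `u₀`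
(`Fluid.IsMildNSSolutionOn (Ioo 0 T) ν 0 u₀ u`), bounded on every closed slab `[0, b] × E`,
`b < T`, with measurable slices on `[0, T)` and jointly measurable on `(0, T) × E`. Then for every
smooth compactly supported `ψ` on the open slab `(0, T) × E` with divergence-free slices,
`∫_{0<t<T} ∫ (⟪u, ∂ₜψ⟫ + ⟪u, (u·∇)ψ⟫ + ν⟪u, Δψ⟫) dx dt = 0`.
Proof: as in `ForwardMildWeak.lean` — with `Λ = ∂ₜψ + νΔψ` and the time support
`[a', b] ⊂ (0, T)` of `ψ`, the identity from `u₀` at `t ∈ (0, b]` tested with `Λ(t)` is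
integrated over `t`; the free term vanishes by
`integral_integral_inner_heatTest_heatAdjointField_eq_zero_of_integrable_heatKernel`, and the
nonlinear term becomes `-∫⟨u, (u·∇)ψ⟩ dτ` by the slab duality and `𝒰[Λ] = -ψ`. [cite: KochNadirashviliSereginSverak2009, §4 (i)–(ii) (arXiv:0709.3599 p. 8)] -/
theorem integral_slab_eq_zero_of_isMildNSSolutionOn_datum {T : ℝ} (hν : 0 < ν) (hT : 0 < T)
    {u₀ : E → E} (hu₀ : AEStronglyMeasurable u₀ volume)
    (hu₀G : ∀ c : ℝ, 0 < c → Integrable (fun x => UnboundedOperators.heatKernel c x * ‖u₀ x‖) volume)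
    (hu : IsMildNSSolutionOn (Ioo 0 T) ν 0 u₀ u)
    (hM : ∀ b < T, ∃ M : ℝ, ∀ t ∈ Icc 0 b, ∀ x, ‖u t x‖ ≤ M)
    (hsl : ∀ t ∈ Ico 0 T, AEStronglyMeasurable (u t) volume)
    (hmeas : AEStronglyMeasurable (uncurry u) ((volume : Measure (ℝ × E)).restrict (Ioo 0 T ×ˢ univ)))
    {ψ : ℝ → E → E} (hψ : IsSpaceTimeTestOn (slab E (Ioo 0 T) isOpen_Ioo) ψ)
    (hdiv : ∀ t, VectorCalculus.IsDivFree (ψ t)) :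
    ∫ t in Ioo 0 T, ∫ x, (⟪u t x, timeDeriv ψ t x⟫ + ⟪u t x, convect (u t) (ψ t) x⟫ +
      ν * ⟪u t x, Δ (ψ t) x⟫) = 0 := by
  -- time support of the test field: `[a', b]`, `0 < a' ≤ b < T`; base time `0`
  obtain ⟨a', b, ha', ha'b, hbT, hsupp⟩ := hψ.exists_time_support_Ioo hT
  have hψ' : IsSpaceTimeTestOn (⊤ : Opens (ℝ × E)) ψ := hψ.mono le_top
  have hab : (0 : ℝ) ≤ b := ha'.le.trans ha'b
  obtain ⟨M, hMb⟩ := hM b hbT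
  -- the adjoint field `Λ = ∂ₜψ + νΔψ`
  set Λ : ℝ → E → E := fun t x => timeDeriv ψ t x + ν • Δ (ψ t) x with hΛ_def
  have hΛ : IsSpaceTimeTestOn (⊤ : Opens (ℝ × E)) Λ := hψ'.heatAdjointField_top ν
  have hΛd : ∀ t, VectorCalculus.IsDivFree (Λ t) := fun t => hψ'.isDivFree_heatAdjointField hdiv ν t
  have hΛsupp : ∀ t, t ∉ Icc a' b → Λ t = 0 := fun t ht =>
    heatAdjointField_eq_zero_of_time_support hsupp ν ht
  have hmeas' : AEStronglyMeasurable (uncurry u) ((volume.restrict (Ioc 0 b)).prod (volume : Measure E)) :=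
    aestronglyMeasurable_uncurry_restrict_Ioc le_rfl hbT hmeas
  have haτ : ∀ τ ∈ Icc 0 b, AEStronglyMeasurable (u τ) volume := fun τ hτ =>
    hsl τ ⟨hτ.1, hτ.2.trans_lt hbT⟩
  have haτ' : ∀ τ ∈ Ioc 0 b, AEStronglyMeasurable (u τ) volume := fun τ hτ =>
    haτ τ (Ioc_subset_Icc_self hτ)
  have haM' : ∀ τ ∈ Ioc 0 b, ∀ x, ‖u τ x‖ ≤ M := fun τ hτ => hMb τ (Ioc_subset_Icc_self hτ)
  -- the identity from the datum at `t ∈ (0, b]`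
  have hid : ∀ t ∈ Ioc 0 b, IsMildNSSolutionFrom ν 0 u₀ u t := fun t ht =>
    hu.2 t ⟨ht.1, ht.2.trans_lt hbT⟩
  -- (1) slab duality for `Λ`
  obtain ⟨R, -, hK1⟩ := hΛ.exists_integral_norm_transportKernel_le hν
  have hslab : ∀ t ∈ Ioc 0 b, ((∫ x, ⟪u t x, Λ t x⟫) - ∫ x, ⟪u₀ x, heatTest ν (Λ t) t x⟫) =
      ∫ y, ⟪u y.1 y.2, (if y.1 < t then fderiv ℝ (heatTest ν (Λ t) (t - y.1)) y.2 else 0) (u y.1 y.2)⟫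
        ∂((volume.restrict (Ioc 0 b)).prod (volume : Measure E)) := fun t ht =>
    integral_inner_sub_eq_slab_of_isMildNSSolutionFrom hν hab hMb haτ hmeas' hΛ hΛd ht (hid t ht)
  have h1 : ∫ t in Ioc 0 b, ((∫ x, ⟪u t x, Λ t x⟫) - ∫ x, ⟪u₀ x, heatTest ν (Λ t) t x⟫) =
      ∫ τ in Ioc 0 b, ∫ x, ⟪u τ x, fderiv ℝ (heatDuhamelBack ν Λ τ) x (u τ x)⟫ :=
    setIntegral_slab_duality_of_norm_le (a := u)
      (K := fun (t' : ℝ) (y : ℝ × E) => if y.1 < t' then fderiv ℝ (heatTest ν (Λ t') (t' - y.1)) y.2 else 0)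
      hab hK1 (hΛ.aestronglyMeasurable_transportKernel hν _)
      (fun t => hΛ.aestronglyMeasurable_transportKernel_slice hν t _) hmeas' haτ hMb hslab
      (fun y hy => ⟨hΛ.integrableOn_transportKernel_time hν 0 b y.1 y.2,
        hΛ.setIntegral_transportKernel_eq_fderiv_heatDuhamelBack hν hΛsupp le_rfl
          (Ioc_subset_Icc_self hy) y.2⟩)
  -- (2) `D𝒰[Λ](τ) = -Dψ(τ)` by the backward heat equation
  have h2 : ∀ τ x, fderiv ℝ (heatDuhamelBack ν Λ τ) x = -fderiv ℝ (ψ τ) x := fun τ x => by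
    have h : heatDuhamelBack ν Λ τ = -(ψ τ) :=
      funext fun y => hψ'.heatDuhamelBack_heatAdjointField hν τ y
    rw [h, fderiv_neg]
  -- (3) the free term vanishes
  have h3 : ∫ t in Ioc 0 b, ∫ x, ⟪u₀ x, heatTest ν (Λ t) t x⟫ = 0 := by
    have h := integral_integral_inner_heatTest_heatAdjointField_eq_zero_of_integrable_heatKernel
      hν hu₀ hu₀G hψ' hsupp ha' hab le_rfl
    simpa only [sub_zero] using h
  -- integrability in `t` of the slice pairings on `(0, b]`
  have hP : Integrable (fun t => ∫ x, ⟪u t x, Λ t x⟫) (volume.restrict (Ioc 0 b)) :=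
    (integrable_prod_inner_test_of_norm_le hmeas' haτ' haM' hΛ).integral_prod_left
  have hQ : Integrable (fun t => ∫ x, ⟪u t x, fderiv ℝ (ψ t) x (u t x)⟫) (volume.restrict (Ioc 0 b)) :=
    (integrable_prod_inner_convect_test_of_norm_le hmeas' haτ' haM' hψ').integral_prod_left
  have hTr : Integrable (fun t => ∫ y, ⟪u y.1 y.2,
      (if y.1 < t then fderiv ℝ (heatTest ν (Λ t) (t - y.1)) y.2 else 0) (u y.1 y.2)⟫
        ∂((volume.restrict (Ioc 0 b)).prod (volume : Measure E))) (volume.restrict (Ioc 0 b)) :=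
    (integrable_transportIntegrand_of_norm_le (a := u)
      (K := fun (t' : ℝ) (y : ℝ × E) => if y.1 < t' then fderiv ℝ (heatTest ν (Λ t') (t' - y.1)) y.2 else 0)
      hab hK1 (hΛ.aestronglyMeasurable_transportKernel hν _)
      (fun t => hΛ.aestronglyMeasurable_transportKernel_slice hν t _) hmeas' haτ hMb).integral_prod_left
  have hPL : Integrable (fun t => (∫ x, ⟪u t x, Λ t x⟫) - ∫ x, ⟪u₀ x, heatTest ν (Λ t) t x⟫)
      (volume.restrict (Ioc 0 b)) := by
    refine hTr.congr ?_
    refine (ae_restrict_iff' measurableSet_Ioc).2 (Eventually.of_forall fun t ht => ?_)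
    exact (hslab t ht).symm
  have hLt : Integrable (fun t => ∫ x, ⟪u₀ x, heatTest ν (Λ t) t x⟫)
      (volume.restrict (Ioc 0 b)) := by
    refine (hP.sub hPL).congr (Eventually.of_forall fun t => ?_)
    simp only [Pi.sub_apply]
    ring
  -- (4) `∫ ⟨u, Λ⟩ dt = -∫ ⟨u, (u·∇)ψ⟩ dt`
  have h4 : ∫ t in Ioc 0 b, ∫ x, ⟪u t x, Λ t x⟫ =
      -∫ t in Ioc 0 b, ∫ x, ⟪u t x, fderiv ℝ (ψ t) x (u t x)⟫ := by
    have e : (fun t => ∫ x, ⟪u t x, Λ t x⟫) = fun t =>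
        ((∫ x, ⟪u t x, Λ t x⟫) - ∫ x, ⟪u₀ x, heatTest ν (Λ t) t x⟫) +
          ∫ x, ⟪u₀ x, heatTest ν (Λ t) t x⟫ := by
      funext t; ring
    rw [e, integral_add hPL hLt, h3, add_zero, h1, ← integral_neg]
    refine setIntegral_congr_fun measurableSet_Ioc fun τ _ => ?_
    rw [← integral_neg]
    refine integral_congr_ae (Eventually.of_forall fun x => ?_)
    show ⟪u τ x, fderiv ℝ (heatDuhamelBack ν Λ τ) x (u τ x)⟫ = -⟪u τ x, fderiv ℝ (ψ τ) x (u τ x)⟫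
    rw [h2, neg_apply, inner_neg_right]
  -- (5) reduce the weak identity to `(0, b]` and conclude
  have hvan : ∀ t ∈ Ioo (0 : ℝ) T \ Ioc 0 b,
      (∫ x, (⟪u t x, timeDeriv ψ t x⟫ + ⟪u t x, convect (u t) (ψ t) x⟫ + ν * ⟪u t x, Δ (ψ t) x⟫)) = 0 := by
    intro t ht
    have ht' : t ∉ Icc a' b := fun h => ht.2 ⟨ht.1.1, h.2⟩
    have hψt : ψ t = 0 := hsupp t ht'
    have hdt : timeDeriv ψ t = 0 := timeDeriv_eq_zero_of_time_support hsupp ht'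
    have hdt' : ∀ x, deriv (fun s => ψ s x) t = 0 := fun x => by
      have h := congrFun hdt x
      simpa [timeDeriv] using h
    have hΔt : Δ (ψ t) = 0 := by
      rw [hψt]
      exact InnerProductSpace.laplacian_const (E := E) (c := (0 : E))
    have hDt : ∀ x, fderiv ℝ (ψ t) x = 0 := fun x => by
      rw [hψt]
      exact fderiv_const_apply 0
    simp [hdt', hΔt, hDt]
  rw [setIntegral_eq_of_subset_of_forall_sdiff_eq_zero (s := Ioc 0 b) measurableSet_Ioo
    (fun t ht => (⟨ht.1, ht.2.trans_lt hbT⟩ : t ∈ Ioo 0 T)) hvan]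
  have e5 : ∀ t ∈ Ioc 0 b,
      (∫ x, (⟪u t x, timeDeriv ψ t x⟫ + ⟪u t x, convect (u t) (ψ t) x⟫ + ν * ⟪u t x, Δ (ψ t) x⟫)) =
        (∫ x, ⟪u t x, Λ t x⟫) + ∫ x, ⟪u t x, fderiv ℝ (ψ t) x (u t x)⟫ := by
    intro t ht
    have iP : Integrable (fun x => ⟪u t x, Λ t x⟫) volume :=
      integrable_inner_of_aestronglyMeasurable_of_norm_le (haτ' t ht) (haM' t ht)
        ((hΛ.contDiff_slice t).continuous.integrable_of_hasCompactSupport (hΛ.hasCompactSupport_slice t))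
    have iQ : Integrable (fun x => ⟪u t x, fderiv ℝ (ψ t) x (u t x)⟫) volume :=
      (integrable_inner_clm_apply_of_norm_le (haτ' t ht) (haM' t ht)
        ((hψ'.fderiv_top.contDiff_slice t).continuous.integrable_of_hasCompactSupport
          (hψ'.fderiv_top.hasCompactSupport_slice t))).1
    rw [← integral_add iP iQ]
    refine integral_congr_ae (Eventually.of_forall fun x => ?_)
    simp only [hΛ_def, inner_add_right, real_inner_smul_right, convect_apply]
    ring
  rw [setIntegral_congr_fun measurableSet_Ioc e5, integral_add hP hQ, h4, neg_add_cancel]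


end FreeTerm

/-! ### Localisation in time: from the weak form to the projected equation for smooth fields -/

section Localisation

variable {F' : Type*} [NormedAddCommGroup F'] [InnerProductSpace ℝ F']

omit [FiniteDimensional ℝ E] [MeasurableSpace E] [BorelSpace E] in
/-- A product `ζ(t) g(t)` with `tsupport ζ ⊆ U`, `U` open, `ζ` continuous and `g` continuous
on `U` is continuous on `ℝ` (outside `U` it vanishes near every point). [folklore] -/
theorem continuous_mul_of_tsupport_subset {ζ g : ℝ → ℝ} {U : Set ℝ} (hU : IsOpen U)
    (hζ : Continuous ζ) (hζU : tsupport ζ ⊆ U) (hg : ContinuousOn g U) :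
    Continuous fun s => ζ s * g s := by
  refine continuous_iff_continuousAt.2 fun s => ?_
  by_cases hs : s ∈ U
  · exact hζ.continuousAt.mul (hg.continuousAt (hU.mem_nhds hs))
  · have h0 : ζ =ᶠ[𝓝 s] 0 := notMem_tsupport_iff_eventuallyEq.1 fun h => hs (hζU h)
    have h1 : (fun s => ζ s * g s) =ᶠ[𝓝 s] fun _ => (0 : ℝ) :=
      h0.mono fun y hy => by simp [hy]
    exact h1.continuousAt

omit [InnerProductSpace ℝ E] [FiniteDimensional ℝ E] [MeasurableSpace E] [BorelSpace E] in
/-- Joint continuity of `(t, x) ↦ ζ(t) W(t, x)` on `ℝ × E` for `tsupport ζ ⊆ U` open and `W`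
jointly continuous on `U × E` (outside `U × E` the product vanishes near every point). [folklore] -/
theorem continuous_uncurry_smul_of_tsupport_subset {ζ : ℝ → ℝ} {W : ℝ → E → F'} {U : Set ℝ}
    (hU : IsOpen U) (hζ : Continuous ζ) (hζU : tsupport ζ ⊆ U)
    (hW : ContinuousOn (uncurry W) (U ×ˢ univ)) :
    Continuous fun q : ℝ × E => ζ q.1 • W q.1 q.2 := by
  refine continuous_iff_continuousAt.2 fun q => ?_
  by_cases hs : q.1 ∈ U
  · have h1 : ContinuousAt (uncurry W) q :=
      hW.continuousAt ((hU.prod isOpen_univ).mem_nhds (mk_mem_prod hs (mem_univ _)))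
    exact ((hζ.comp continuous_fst).continuousAt).smul h1
  · have h0 : ζ =ᶠ[𝓝 q.1] 0 := notMem_tsupport_iff_eventuallyEq.1 fun h => hs (hζU h)
    have h0' : (fun q : ℝ × E => ζ q.1) =ᶠ[𝓝 q] 0 :=
      (continuous_fst.continuousAt (x := q)).eventually h0 |>.mono fun y hy => hy
    have h1 : (fun q : ℝ × E => ζ q.1 • W q.1 q.2) =ᶠ[𝓝 q] fun _ => (0 : F') :=
      h0'.mono fun y hy => by simp [hy]
    exact h1.continuousAt

/-- **Continuity in time of `x`-integrals of jointly continuous, uniformly compactly supported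
integrands** on an open time interval: if `W` is jointly continuous on `(0, T) × E` and
`W(t, x) = 0` for `x` off a fixed compact `K`, then `t ↦ ∫ W(t, x) dx` is continuous on `(0, T)`
(dominated convergence on compact time neighbourhoods, bound `sup |W| · 1_K`). [folklore] -/
theorem continuousOn_Ioo_integral {W : ℝ → E → F'} {T : ℝ}
    (hW : ContinuousOn (uncurry W) (Ioo 0 T ×ˢ univ)) {K : Set E} (hK : IsCompact K)
    (hWK : ∀ t ∈ Ioo 0 T, ∀ x ∉ K, W t x = 0) :
    ContinuousOn (fun t => ∫ x, W t x) (Ioo 0 T) := by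
  intro t₀ ht₀
  set s : Set ℝ := Icc (t₀ / 2) ((t₀ + T) / 2) with hs
  have hsI : s ⊆ Ioo 0 T := fun t ht => ⟨by linarith [ht.1, ht₀.1], by linarith [ht.2, ht₀.2]⟩
  have hsn : s ∈ 𝓝 t₀ := Icc_mem_nhds (by linarith [ht₀.1]) (by linarith [ht₀.2])
  have hslice : ∀ t ∈ Ioo 0 T, Continuous (W t) := fun t ht =>
    hW.comp_continuous (f := fun x : E => ((t, x) : ℝ × E)) (by fun_prop)
      fun x => mk_mem_prod ht (mem_univ x)
  -- a uniform bound on the compact `s × K`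
  obtain ⟨C, hC⟩ := (isCompact_Icc.prod hK).exists_bound_of_continuousOn
    (hW.mono (prod_mono hsI (subset_univ _)))
  have hcont : ContinuousOn (fun t => ∫ x, W t x) s := by
    refine continuousOn_of_dominated (bound := K.indicator fun _ => C) ?_ ?_ ?_ ?_
    · exact fun t ht => (hslice t (hsI ht)).aestronglyMeasurable
    · intro t ht
      refine Eventually.of_forall fun x => ?_
      by_cases hx : x ∈ K
      · rw [indicator_of_mem hx]
        exact hC (t, x) (mk_mem_prod ht hx)
      · rw [indicator_of_notMem hx, hWK t (hsI ht) x hx, norm_zero]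
    · exact (integrableOn_const hK.measure_lt_top.ne).integrable_indicator hK.measurableSet
    · refine Eventually.of_forall fun x => ?_
      have h := hW.comp (f := fun t : ℝ => ((t, x) : ℝ × E)) (s := Ioo 0 T)
        (by fun_prop : Continuous fun t : ℝ => ((t, x) : ℝ × E)).continuousOn
        (fun t ht => mk_mem_prod ht (mem_univ x))
      exact h.mono hsI
  exact (hcont.continuousAt hsn).continuousWithinAt


variable {T ν : ℝ} {v : ℝ → E → E}

omit [FiniteDimensional ℝ E] [MeasurableSpace E] [BorelSpace E] in
/-- **Integration by parts in time on each space fibre**: for `η ∈ C_c^∞` with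
`tsupport η ⊆ (0, T)` and `v` jointly smooth on `(0, T) × E`,
`∫ (η' ⟪v, φ⟫ + η ⟪∂ₜv, φ⟫) dt = 0` (the integrand is the derivative of the compactly supported
`C¹` function `η ⟪v(·, x), φ(x)⟫`, extended by zero; Mathlib
`integral_eq_zero_of_hasDerivAt_of_integrable`). [folklore] -/
theorem integral_deriv_mul_inner_add_eq_zero (hv : IsSmoothSpaceTimeOn (Ioo 0 T) v)
    {η : ℝ → ℝ} (hη : ContDiff ℝ (⊤ : ℕ∞) η) (hηc : HasCompactSupport η) (hηI : tsupport η ⊆ Ioo 0 T)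
    (φ : E → E) (x : E) :
    ∫ s, (deriv η s * ⟪v s x, φ x⟫ + η s * ⟪timeDerivWithin (Ioo 0 T) v s x, φ x⟫) = 0 := by
  have hSU : UniqueDiffOn ℝ (Ioo 0 T) := isOpen_Ioo.uniqueDiffOn
  have hηd : Differentiable ℝ η := hη.differentiable (by simp)
  have hg : ContinuousOn (fun s => ⟪v s x, φ x⟫) (Ioo 0 T) := by
    have h := hv.continuousOn.comp (f := fun t : ℝ => ((t, x) : ℝ × E)) (s := Ioo 0 T)
      (by fun_prop : Continuous fun t : ℝ => ((t, x) : ℝ × E)).continuousOn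
      (fun t ht => mk_mem_prod ht (mem_univ x))
    exact h.inner continuousOn_const
  have hg₁ : ContinuousOn (fun s => ⟪timeDerivWithin (Ioo 0 T) v s x, φ x⟫) (Ioo 0 T) := by
    have h := (hv.timeDerivWithin hSU).continuousOn.comp (f := fun t : ℝ => ((t, x) : ℝ × E))
      (s := Ioo 0 T) (by fun_prop : Continuous fun t : ℝ => ((t, x) : ℝ × E)).continuousOn
      (fun t ht => mk_mem_prod ht (mem_univ x))
    exact h.inner continuousOn_const
  -- the derivative everywhere
  have hderiv : ∀ s, HasDerivAt (fun s => η s * ⟪v s x, φ x⟫)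
      (deriv η s * ⟪v s x, φ x⟫ + η s * ⟪timeDerivWithin (Ioo 0 T) v s x, φ x⟫) s := by
    intro s
    by_cases hs : s ∈ Ioo 0 T
    · have h1 : HasDerivAt (fun s => v s x) (timeDerivWithin (Ioo 0 T) v s x) s :=
        (hv.hasDerivWithinAt_timeDerivWithin hSU hs x).hasDerivAt (isOpen_Ioo.mem_nhds hs)
      have h2 : HasDerivAt (fun s => ⟪v s x, φ x⟫) ⟪timeDerivWithin (Ioo 0 T) v s x, φ x⟫ s := by
        have h := h1.inner ℝ (hasDerivAt_const s (φ x))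
        simpa using h
      exact (hηd s).hasDerivAt.mul h2
    · have h0 : η =ᶠ[𝓝 s] 0 := notMem_tsupport_iff_eventuallyEq.1 fun h => hs (hηI h)
      have hηs : η s = 0 := h0.self_of_nhds
      have hdηs : deriv η s = 0 := by rw [h0.deriv_eq]; exact deriv_const s 0
      have hp : (fun s => η s * ⟪v s x, φ x⟫) =ᶠ[𝓝 s] fun _ => (0 : ℝ) :=
        h0.mono fun y hy => by simp [hy]
      rw [hηs, hdηs, zero_mul, zero_mul, add_zero]
      exact (hasDerivAt_const s (0 : ℝ)).congr_of_eventuallyEq hp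
  have hp_cont : Continuous fun s => η s * ⟪v s x, φ x⟫ :=
    continuous_mul_of_tsupport_subset isOpen_Ioo hη.continuous hηI hg
  have hq_cont : Continuous fun s =>
      deriv η s * ⟪v s x, φ x⟫ + η s * ⟪timeDerivWithin (Ioo 0 T) v s x, φ x⟫ :=
    (continuous_mul_of_tsupport_subset isOpen_Ioo (hη.continuous_deriv (by simp))
      (tsupport_deriv_subset.trans hηI) hg).add
      (continuous_mul_of_tsupport_subset isOpen_Ioo hη.continuous hηI hg₁)
  have hp_supp : HasCompactSupport fun s => η s * ⟪v s x, φ x⟫ := hηc.mul_right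
  have hq_supp : HasCompactSupport fun s =>
      deriv η s * ⟪v s x, φ x⟫ + η s * ⟪timeDerivWithin (Ioo 0 T) v s x, φ x⟫ :=
    hηc.deriv.mul_right.add hηc.mul_right
  exact integral_eq_zero_of_hasDerivAt_of_integrable hderiv
    (hq_cont.integrable_of_hasCompactSupport hq_supp) (hp_cont.integrable_of_hasCompactSupport hp_supp)


/-- Slice integrability of the pairings `⟪w, φ⟫`, `⟪w, (w·∇)φ⟫`, `⟪w, (w·∇)φ⟫ + ν⟪w, Δφ⟫` of a
continuous field `w` with a test field `φ` (continuous integrands of compact support). [folklore] -/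
theorem integrable_inner_test_slices {w : E → E} (hw : Continuous w) {φ : E → E}
    (hφ : FunctionSpaces.IsTestFunctionOn (⊤ : Opens E) φ) (ν : ℝ) :
    Integrable (fun x => ⟪w x, φ x⟫) (volume : Measure E) ∧
      Integrable (fun x => ⟪w x, convect w φ x⟫) (volume : Measure E) ∧
      Integrable (fun x => ⟪w x, convect w φ x⟫ + ν * ⟪w x, (Δ φ) x⟫) (volume : Measure E) := by
  have hφ1 : ContDiff ℝ 1 φ := (contDiff_infty.1 hφ.contDiff _)
  have hφ2 : ContDiff ℝ 2 φ := (contDiff_infty.1 hφ.contDiff _)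
  have hc := hφ.hasCompactSupport
  have i1 := integrable_inner_of_hasCompactSupport_right hw hφ.contDiff.continuous hc
  have i2 : Integrable (fun x => ⟪w x, convect w φ x⟫) (volume : Measure E) :=
    integrable_inner_of_hasCompactSupport_right hw
      ((hφ1.continuous_fderiv one_ne_zero).clm_apply hw)
      ((hc.fderiv (𝕜 := ℝ)).mono fun x hx => by
        contrapose! hx; simp only [mem_support, not_not] at hx; simp [convect, hx])
  have i3 : Integrable (fun x => ⟪w x, (Δ φ) x⟫) (volume : Measure E) :=
    integrable_inner_of_hasCompactSupport_right hw (continuous_laplacian hφ2)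
      (hasCompactSupport_laplacian hc)
  exact ⟨i1, i2, i2.add (i3.const_mul ν)⟩

/-- **The weak form tested with `η(t)φ(x)`**: for `η ∈ C_c^∞((0, T))`, a solenoidal test `φ`
and a field `v` jointly smooth on `(0, T) × E` satisfying the space–time weak identity,
`∫_{(0,T)} (η'(t) ⟨v, φ⟩ + η(t) (⟨v, (v·∇)φ⟩ + ν⟨v, Δφ⟩)) dt = 0` (`ψ = η φ` is a test field on
the slab with solenoidal slices, `∂ₜψ = η'φ`, `(v·∇)ψ = η (v·∇)φ`, `Δψ = η Δφ`). [folklore] -/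
theorem setIntegral_deriv_mul_add_eq_zero_of_weak (hv : IsSmoothSpaceTimeOn (Ioo 0 T) v)
    (hweak : ∀ ψ : ℝ → E → E, IsSpaceTimeTestOn (slab E (Ioo 0 T) isOpen_Ioo) ψ →
      (∀ t, VectorCalculus.IsDivFree (ψ t)) →
      ∫ t in Ioo 0 T, ∫ x, (⟪v t x, timeDeriv ψ t x⟫ + ⟪v t x, convect (v t) (ψ t) x⟫ +
        ν * ⟪v t x, Δ (ψ t) x⟫) = 0)
    {η : ℝ → ℝ} (hη : ContDiff ℝ (⊤ : ℕ∞) η) (hηc : HasCompactSupport η) (hηI : tsupport η ⊆ Ioo 0 T)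
    {φ : E → E} (hφ : FunctionSpaces.IsTestFunctionOn (⊤ : Opens E) φ)
    (hφd : VectorCalculus.IsDivFree φ) :
    ∫ t in Ioo 0 T, ((deriv η t * ∫ x, ⟪v t x, φ x⟫) +
      η t * ∫ x, (⟪v t x, convect (v t) φ x⟫ + ν * ⟪v t x, (Δ φ) x⟫)) = 0 := by
  have hφ2 : ContDiff ℝ 2 φ := (contDiff_infty.1 hφ.contDiff _)
  have hφdiff : Differentiable ℝ φ := hφ.contDiff.differentiable (by simp)
  have hηd : Differentiable ℝ η := hη.differentiable (by simp)
  set ψ : ℝ → E → E := fun t x => η t • φ x with hψ_def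
  have hψ : IsSpaceTimeTestOn (slab E (Ioo 0 T) isOpen_Ioo) ψ :=
    isSpaceTimeTestOn_slab_smul isOpen_Ioo hη hηc hηI hφ
  have hψd : ∀ t, VectorCalculus.IsDivFree (ψ t) := fun t x => by
    show VectorCalculus.divergence (fun y => η t • φ y) x = 0
    rw [divergence_fun_const_smul (hφdiff x), hφd x, mul_zero]
  have key := hweak ψ hψ hψd
  have e0 : ∫ t in Ioo 0 T, ((deriv η t * ∫ x, ⟪v t x, φ x⟫) +
      η t * ∫ x, (⟪v t x, convect (v t) φ x⟫ + ν * ⟪v t x, (Δ φ) x⟫)) =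
      ∫ t in Ioo 0 T, ∫ x, (⟪v t x, timeDeriv ψ t x⟫ + ⟪v t x, convect (v t) (ψ t) x⟫ +
        ν * ⟪v t x, Δ (ψ t) x⟫) := by
    refine setIntegral_congr_fun measurableSet_Ioo fun t ht => ?_
    have hvt : Continuous (v t) := (hv.contDiff_slice ht).continuous
    obtain ⟨i1, i2, i3⟩ := integrable_inner_test_slices hvt hφ ν
    have e : ∀ x, ⟪v t x, timeDeriv ψ t x⟫ + ⟪v t x, convect (v t) (ψ t) x⟫ +
        ν * ⟪v t x, Δ (ψ t) x⟫ =
        deriv η t * ⟪v t x, φ x⟫ + η t * (⟪v t x, convect (v t) φ x⟫ + ν * ⟪v t x, (Δ φ) x⟫) := by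
      intro x
      have h1 : timeDeriv ψ t x = deriv η t • φ x := by
        rw [timeDeriv_apply]
        exact deriv_smul_const (hηd t) (φ x)
      have h2 : convect (v t) (ψ t) x = η t • convect (v t) φ x :=
        convect_fun_const_smul (v t) (hφdiff x) (η t)
      have h3 : Δ (ψ t) x = η t • (Δ φ) x := laplacian_fun_const_smul hφ2 (η t) x
      rw [h1, h2, h3]
      simp only [real_inner_smul_right]
      ring
    show _ = ∫ x, (⟪v t x, timeDeriv ψ t x⟫ + ⟪v t x, convect (v t) (ψ t) x⟫ + ν * ⟪v t x, Δ (ψ t) x⟫)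
    simp_rw [e]
    rw [integral_add (i1.const_mul _) (i3.const_mul _), integral_const_mul, integral_const_mul]
  rw [e0]
  exact key

/-- **`∫_{(0,T)} (η' ⟨v, φ⟩ + η ⟨∂ₜv, φ⟩) dt = 0`**: the fibrewise integration by parts
`integral_deriv_mul_inner_add_eq_zero` integrated in `x` (Fubini for the jointly continuous,
compactly supported integrand `η'⟪v, φ⟫ + η⟪∂ₜv, φ⟫` on `ℝ × E`). [folklore] -/
theorem setIntegral_deriv_mul_add_timeDeriv_eq_zero (hv : IsSmoothSpaceTimeOn (Ioo 0 T) v)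
    {η : ℝ → ℝ} (hη : ContDiff ℝ (⊤ : ℕ∞) η) (hηc : HasCompactSupport η) (hηI : tsupport η ⊆ Ioo 0 T)
    {φ : E → E} (hφ : FunctionSpaces.IsTestFunctionOn (⊤ : Opens E) φ) :
    ∫ t in Ioo 0 T, ((deriv η t * ∫ x, ⟪v t x, φ x⟫) +
      η t * ∫ x, ⟪timeDerivWithin (Ioo 0 T) v t x, φ x⟫) = 0 := by
  have hSU : UniqueDiffOn ℝ (Ioo 0 T) := isOpen_Ioo.uniqueDiffOn
  have hdv := hv.timeDerivWithin hSU
  have hc := hφ.hasCompactSupport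
  -- the jointly continuous, compactly supported integrand `Q`
  set Q : ℝ × E → ℝ := fun q => deriv η q.1 * ⟪v q.1 q.2, φ q.2⟫ +
    η q.1 * ⟪timeDerivWithin (Ioo 0 T) v q.1 q.2, φ q.2⟫ with hQ
  have hW₁ : ContinuousOn (uncurry fun t x => ⟪v t x, φ x⟫) (Ioo 0 T ×ˢ univ) :=
    hv.continuousOn.inner (hφ.contDiff.continuous.comp continuous_snd).continuousOn
  have hW₂ : ContinuousOn (uncurry fun t x => ⟪timeDerivWithin (Ioo 0 T) v t x, φ x⟫)
      (Ioo 0 T ×ˢ univ) :=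
    hdv.continuousOn.inner (hφ.contDiff.continuous.comp continuous_snd).continuousOn
  have hQc : Continuous Q := by
    have h1 := continuous_uncurry_smul_of_tsupport_subset (F' := ℝ) isOpen_Ioo
      (hη.continuous_deriv (by simp)) (tsupport_deriv_subset.trans hηI) hW₁
    have h2 := continuous_uncurry_smul_of_tsupport_subset (F' := ℝ) isOpen_Ioo hη.continuous hηI hW₂
    have h1' : Continuous fun q : ℝ × E => deriv η q.1 * ⟪v q.1 q.2, φ q.2⟫ := by
      simpa only [smul_eq_mul] using h1
    have h2' : Continuous fun q : ℝ × E => η q.1 * ⟪timeDerivWithin (Ioo 0 T) v q.1 q.2, φ q.2⟫ := by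
      simpa only [smul_eq_mul] using h2
    exact h1'.add h2'
  have hQsupp : HasCompactSupport Q := by
    refine HasCompactSupport.intro (hηc.prod hc) ?_
    rintro ⟨t, x⟩ hq
    rcases not_and_or.1 (fun h => hq (mem_prod.2 h)) with h | h
    · have hηt : η t = 0 := image_eq_zero_of_notMem_tsupport h
      have hdt : deriv η t = 0 := image_eq_zero_of_notMem_tsupport fun h' => h (tsupport_deriv_subset h')
      simp [hQ, hηt, hdt]
    · simp [hQ, image_eq_zero_of_notMem_tsupport h]
  have hQint : Integrable Q ((volume : Measure ℝ).restrict (Ioo 0 T) |>.prod (volume : Measure E)) := by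
    have h : Integrable Q ((volume : Measure ℝ).prod (volume : Measure E)) :=
      hQc.integrable_of_hasCompactSupport (μ := (volume : Measure ℝ).prod (volume : Measure E)) hQsupp
    rw [Measure.restrict_prod_eq_prod_univ]
    exact h.integrableOn
  -- rewrite the left-hand side as an iterated integral of `Q` and swap
  have e1 : ∫ t in Ioo 0 T, ((deriv η t * ∫ x, ⟪v t x, φ x⟫) +
      η t * ∫ x, ⟪timeDerivWithin (Ioo 0 T) v t x, φ x⟫) = ∫ t in Ioo 0 T, ∫ x, Q (t, x) := by
    refine setIntegral_congr_fun measurableSet_Ioo fun t ht => ?_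
    have hvt : Continuous (v t) := (hv.contDiff_slice ht).continuous
    have hdvt : Continuous (timeDerivWithin (Ioo 0 T) v t) := (hdv.contDiff_slice ht).continuous
    have i1 := integrable_inner_of_hasCompactSupport_right hvt hφ.contDiff.continuous hc
    have i2 := integrable_inner_of_hasCompactSupport_right hdvt hφ.contDiff.continuous hc
    show _ = ∫ x, (deriv η t * ⟪v t x, φ x⟫ + η t * ⟪timeDerivWithin (Ioo 0 T) v t x, φ x⟫)
    rw [integral_add (i1.const_mul _) (i2.const_mul _), integral_const_mul, integral_const_mul]
  rw [e1]
  have hQint' : Integrable (uncurry fun (t : ℝ) (x : E) => Q (t, x))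
      ((volume : Measure ℝ).restrict (Ioo 0 T) |>.prod (volume : Measure E)) := hQint
  rw [integral_integral_swap hQint']
  -- each fibre integral vanishes
  have e2 : ∀ x, ∫ t in Ioo 0 T, Q (t, x) = 0 := by
    intro x
    rw [setIntegral_eq_integral_of_forall_compl_eq_zero (μ := (volume : Measure ℝ))
      (s := Ioo 0 T) (fun t ht => ?_)]
    · exact integral_deriv_mul_inner_add_eq_zero hv hη hηc hηI φ x
    · have h : t ∉ tsupport η := fun h' => ht (hηI h')
      have hηt : η t = 0 := image_eq_zero_of_notMem_tsupport h
      have hdt : deriv η t = 0 := image_eq_zero_of_notMem_tsupport fun h' => h (tsupport_deriv_subset h')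
      simp [hQ, hηt, hdt]
  simp [e2]


/-- **Smooth weakly divergence-free fields are divergence free**: `∫ θ div w = -∫ ⟪w, ∇θ⟫ = 0`
for all tests `θ` (`integral_mul_divergence_add_eq_zero_left`), so `div w = 0` a.e. (du
Bois-Reymond, Mathlib `ae_eq_zero_of_integral_contDiff_smul_eq_zero`), hence everywhere by
continuity (Evans, *PDE*, §5.2.1). [folklore] -/
theorem IsWeaklyDivFree.isDivFree_of_contDiff {w : E → E} (hw : ContDiff ℝ 1 w)
    (hdiv : IsWeaklyDivFree w) : VectorCalculus.IsDivFree w := by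
  have hcont : Continuous (VectorCalculus.divergence w) :=
    continuous_divergence (hw.continuous_fderiv one_ne_zero)
  have hae : ∀ᵐ x ∂(volume : Measure E), VectorCalculus.divergence w x = 0 := by
    refine ae_eq_zero_of_integral_contDiff_smul_eq_zero hcont.locallyIntegrable fun θ hθ hθc => ?_
    have h := integral_mul_divergence_add_eq_zero_left (hθ.of_le (by exact_mod_cast le_top)) hw hθc
    have h0 : ∫ x, ⟪w x, gradient θ x⟫ = 0 := hdiv θ ⟨hθ, hθc, by simp⟩
    simp only [smul_eq_mul]
    linarith
  intro x
  have h := (Continuous.ae_eq_iff_eq volume hcont continuous_const).1 hae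
  exact congrFun h x

/-- Continuous functions which are essentially bounded are bounded everywhere: the exceptional
set `{‖f‖ > C}` is open and null, hence empty (Lebesgue measure charges open sets). [folklore] -/
theorem norm_le_of_eLpNorm_top_le_of_continuous {F' : Type*} [NormedAddCommGroup F'] {f : E → F'}
    (hf : Continuous f) {C : ℝ≥0∞} (hC : C ≠ ∞) (h : eLpNorm f ∞ (volume : Measure E) ≤ C) (x : E) :
    ‖f x‖ ≤ C.toReal := by
  have hae : ∀ᵐ y ∂(volume : Measure E), ‖f y‖ ≤ C.toReal := by
    have h1 := ae_le_eLpNormEssSup (μ := (volume : Measure E)) (f := f)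
    filter_upwards [h1] with y hy
    rw [eLpNorm_exponent_top] at h
    have h2 : ‖f y‖ₑ ≤ C := hy.trans h
    rw [← ofReal_norm] at h2
    exact (ENNReal.ofReal_le_iff_le_toReal hC).1 h2
  have hopen : IsOpen {y : E | C.toReal < ‖f y‖} := isOpen_lt continuous_const hf.norm
  have hnull : (volume : Measure E) {y : E | C.toReal < ‖f y‖} = 0 := by
    rw [ae_iff] at hae
    simpa only [not_le] using hae
  have hempty := hopen.eq_empty_of_measure_zero hnull
  by_contra hx
  have : x ∈ {y : E | C.toReal < ‖f y‖} := not_le.1 hx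
  rw [hempty] at this
  exact this

/-- **From the weak form to the projected momentum equation for smooth fields**: if `v` is
jointly smooth on `(0, T) × E`, divergence free, and satisfies the space–time weak identity for
every test field on the open slab with divergence-free slices, then for every `t ∈ (0, T)` and
every solenoidal test `φ`, `∫ ⟪∂ₜv + (v·∇)v − νΔv, φ⟫ = 0` (test with `ψ = η(t)φ(x)`, integrate
by parts in `t`, du Bois-Reymond in `t` — Mathlib `IsOpen.ae_eq_zero_of_integral_contDiff_smul_eq_zero`
and continuity —, then integrate by parts in `x`: `integral_inner_convect_add_eq_zero` with
`div v = 0`, `integral_inner_laplacian_comm`). This is the projected (pressure-free) form of the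
equations consumed by `exists_isClassicalNSSolutionOn_of_forall_integral_inner_eq_zero`
(Fabes–Jones–Rivière 1972, Thm. 2.1 (i) ⇔ (ii) for regular fields). [cite: FabesJonesRiviere1972, Thm. 2.1] -/
theorem integral_inner_momentum_eq_zero_of_slab_weak (hv : IsSmoothSpaceTimeOn (Ioo 0 T) v)
    (hdivv : ∀ t ∈ Ioo 0 T, VectorCalculus.IsDivFree (v t))
    (hweak : ∀ ψ : ℝ → E → E, IsSpaceTimeTestOn (slab E (Ioo 0 T) isOpen_Ioo) ψ →
      (∀ t, VectorCalculus.IsDivFree (ψ t)) →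
      ∫ t in Ioo 0 T, ∫ x, (⟪v t x, timeDeriv ψ t x⟫ + ⟪v t x, convect (v t) (ψ t) x⟫ +
        ν * ⟪v t x, Δ (ψ t) x⟫) = 0)
    {t : ℝ} (ht : t ∈ Ioo 0 T) {φ : E → E} (hφ : FunctionSpaces.IsTestFunctionOn (⊤ : Opens E) φ)
    (hφd : VectorCalculus.IsDivFree φ) :
    ∫ x, ⟪timeDerivWithin (Ioo 0 T) v t x + convect (v t) (v t) x - ν • (Δ (v t)) x -
      (0 : ℝ → E → E) t x, φ x⟫ = 0 := by
  have hSU : UniqueDiffOn ℝ (Ioo 0 T) := isOpen_Ioo.uniqueDiffOn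
  have hdv := hv.timeDerivWithin hSU
  have hc := hφ.hasCompactSupport
  have hφ1 : ContDiff ℝ 1 φ := contDiff_infty.1 hφ.contDiff _
  have hφ2 : ContDiff ℝ 2 φ := contDiff_infty.1 hφ.contDiff _
  -- the three time functions
  set G : ℝ → ℝ := fun t => ∫ x, ⟪v t x, φ x⟫ with hG
  set G₁ : ℝ → ℝ := fun t => ∫ x, ⟪timeDerivWithin (Ioo 0 T) v t x, φ x⟫ with hG₁
  set H : ℝ → ℝ := fun t => ∫ x, (⟪v t x, convect (v t) φ x⟫ + ν * ⟪v t x, (Δ φ) x⟫) with hH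
  -- their continuity on `(0, T)`
  have hφc0 : ∀ x ∉ tsupport φ, φ x = 0 := fun x hx => image_eq_zero_of_notMem_tsupport hx
  have hGc : ContinuousOn G (Ioo 0 T) :=
    continuousOn_Ioo_integral (W := fun t x => ⟪v t x, φ x⟫)
      (hv.continuousOn.inner (hφ.contDiff.continuous.comp continuous_snd).continuousOn) hc
      (fun t _ x hx => by simp [hφc0 x hx])
  have hG₁c : ContinuousOn G₁ (Ioo 0 T) :=
    continuousOn_Ioo_integral (W := fun t x => ⟪timeDerivWithin (Ioo 0 T) v t x, φ x⟫)
      (hdv.continuousOn.inner (hφ.contDiff.continuous.comp continuous_snd).continuousOn) hc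
      (fun t _ x hx => by simp [hφc0 x hx])
  have hHc : ContinuousOn H (Ioo 0 T) := by
    refine continuousOn_Ioo_integral
      (W := fun t x => ⟪v t x, convect (v t) φ x⟫ + ν * ⟪v t x, (Δ φ) x⟫) ?_ hc ?_
    · have h1 : ContinuousOn (fun q : ℝ × E => fderiv ℝ φ q.2 (v q.1 q.2)) (Ioo 0 T ×ˢ univ) :=
        ((hφ1.continuous_fderiv one_ne_zero).comp continuous_snd).continuousOn.clm_apply
          hv.continuousOn
      have h2 : ContinuousOn (fun q : ℝ × E => (Δ φ) q.2) (Ioo 0 T ×ˢ univ) :=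
        ((continuous_laplacian hφ2).comp continuous_snd).continuousOn
      exact (hv.continuousOn.inner h1).add (continuousOn_const.mul (hv.continuousOn.inner h2))
    · intro t _ x hx
      simp [convect, fderiv_of_notMem_tsupport ℝ hx, laplacian_eq_zero_of_notMem_tsupport hx]
  -- `∫ η (H - G₁) = 0` for every `η ∈ C_c^∞((0, T))`
  have key : ∀ η : ℝ → ℝ, ContDiff ℝ (⊤ : ℕ∞) η → HasCompactSupport η → tsupport η ⊆ Ioo 0 T →
      ∫ t in Ioo 0 T, η t * (H t - G₁ t) = 0 := by
    intro η hη hηc hηI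
    have hA := setIntegral_deriv_mul_add_eq_zero_of_weak hv hweak hη hηc hηI hφ hφd
    have hB := setIntegral_deriv_mul_add_timeDeriv_eq_zero hv hη hηc hηI hφ
    -- integrability of the time functions
    have hdη : Continuous (deriv η) := hη.continuous_deriv (by simp)
    have hdηI : tsupport (deriv η) ⊆ Ioo 0 T := tsupport_deriv_subset.trans hηI
    have i1 : Integrable (fun t => deriv η t * G t) (volume : Measure ℝ) :=
      (continuous_mul_of_tsupport_subset isOpen_Ioo hdη hdηI hGc).integrable_of_hasCompactSupport
        hηc.deriv.mul_right
    have i2 : Integrable (fun t => η t * H t) (volume : Measure ℝ) :=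
      (continuous_mul_of_tsupport_subset isOpen_Ioo hη.continuous hηI hHc).integrable_of_hasCompactSupport
        hηc.mul_right
    have i3 : Integrable (fun t => η t * G₁ t) (volume : Measure ℝ) :=
      (continuous_mul_of_tsupport_subset isOpen_Ioo hη.continuous hηI hG₁c).integrable_of_hasCompactSupport
        hηc.mul_right
    have hA' : (∫ t in Ioo 0 T, deriv η t * G t) + ∫ t in Ioo 0 T, η t * H t = 0 := by
      rw [← integral_add i1.integrableOn i2.integrableOn]
      exact hA
    have hB' : (∫ t in Ioo 0 T, deriv η t * G t) + ∫ t in Ioo 0 T, η t * G₁ t = 0 := by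
      rw [← integral_add i1.integrableOn i3.integrableOn]
      exact hB
    have e : ∫ t in Ioo 0 T, η t * (H t - G₁ t) =
        (∫ t in Ioo 0 T, η t * H t) - ∫ t in Ioo 0 T, η t * G₁ t := by
      rw [← integral_sub i2.integrableOn i3.integrableOn]
      refine integral_congr_ae (Eventually.of_forall fun t => ?_)
      ring
    rw [e]
    linarith
  -- du Bois-Reymond: `H = G₁` on `(0, T)`
  have hae : ∀ᵐ s ∂(volume : Measure ℝ), s ∈ Ioo 0 T → H s - G₁ s = 0 := by
    refine isOpen_Ioo.ae_eq_zero_of_integral_contDiff_smul_eq_zero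
      ((hHc.sub hG₁c).locallyIntegrableOn measurableSet_Ioo) fun g hg hgc hgI => ?_
    rw [← setIntegral_eq_integral_of_forall_compl_eq_zero (μ := (volume : Measure ℝ))
      (s := Ioo 0 T) (fun s hs => by
        simp [image_eq_zero_of_notMem_tsupport fun h => hs (hgI h)])]
    simp only [smul_eq_mul]
    exact key g hg hgc hgI
  have hEq : EqOn (fun s => H s - G₁ s) (fun _ => (0 : ℝ)) (Ioo 0 T) :=
    Measure.eqOn_open_of_ae_eq ((ae_restrict_iff' measurableSet_Ioo).2 hae) isOpen_Ioo
      (hHc.sub hG₁c) continuousOn_const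
  have hHG : H t = G₁ t := sub_eq_zero.1 (hEq ht)
  -- integrate by parts in `x` at time `t`
  have hvt2 : ContDiff ℝ 2 (v t) := contDiff_infty.1 (hv.contDiff_slice ht) 2
  have hvt1 : ContDiff ℝ 1 (v t) := hvt2.of_le one_le_two
  have hvtc : Continuous (v t) := hvt1.continuous
  have hdvt : Continuous (timeDerivWithin (Ioo 0 T) v t) := (hdv.contDiff_slice ht).continuous
  have iT := integrable_inner_of_hasCompactSupport_right hdvt hφ.contDiff.continuous hc
  have iC : Integrable (fun x => ⟪convect (v t) (v t) x, φ x⟫) (volume : Measure E) :=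
    integrable_inner_of_hasCompactSupport_right
      ((hvt1.continuous_fderiv one_ne_zero).clm_apply hvtc) hφ.contDiff.continuous hc
  have iL := integrable_inner_of_hasCompactSupport_right (continuous_laplacian hvt2)
    hφ.contDiff.continuous hc
  obtain ⟨-, iC', -⟩ := integrable_inner_test_slices hvtc hφ ν
  have iL' : Integrable (fun x => ⟪v t x, (Δ φ) x⟫) (volume : Measure E) :=
    integrable_inner_of_hasCompactSupport_right hvtc (continuous_laplacian hφ2)
      (hasCompactSupport_laplacian hc)
  have eC : ∫ x, ⟪convect (v t) (v t) x, φ x⟫ = -∫ x, ⟪v t x, convect (v t) φ x⟫ := by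
    have h0 := integral_inner_convect_add_eq_zero hvt1 hvt1 hφ1 hc
    have hz : ∫ x, VectorCalculus.divergence (v t) x * ⟪v t x, φ x⟫ = 0 := by
      simp [hdivv t ht _]
    linarith
  have eL : ∫ x, ⟪(Δ (v t)) x, φ x⟫ = ∫ x, ⟪v t x, (Δ φ) x⟫ :=
    integral_inner_laplacian_comm hvt2 hφ2 hc
  have eH : H t = (∫ x, ⟪v t x, convect (v t) φ x⟫) + ν * ∫ x, ⟪v t x, (Δ φ) x⟫ := by
    simp only [hH]
    rw [integral_add iC' (iL'.const_mul ν), integral_const_mul]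
  -- assemble
  have e1 : ∀ x, ⟪timeDerivWithin (Ioo 0 T) v t x + convect (v t) (v t) x - ν • (Δ (v t)) x -
      (0 : ℝ → E → E) t x, φ x⟫ = ⟪timeDerivWithin (Ioo 0 T) v t x, φ x⟫ +
        ⟪convect (v t) (v t) x, φ x⟫ - ν * ⟪(Δ (v t)) x, φ x⟫ := by
    intro x
    simp only [Pi.zero_apply, sub_zero, inner_add_left, inner_sub_left, real_inner_smul_left]
  have iTC : Integrable (fun x => ⟪timeDerivWithin (Ioo 0 T) v t x, φ x⟫ +
      ⟪convect (v t) (v t) x, φ x⟫) (volume : Measure E) := iT.add iC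
  have iLν : Integrable (fun x => ν * ⟪(Δ (v t)) x, φ x⟫) (volume : Measure E) := iL.const_mul ν
  rw [integral_congr_ae (Eventually.of_forall e1), integral_sub iTC iLν,
    integral_add iT iC, integral_const_mul, eC, eL]
  have hG₁t : G₁ t = ∫ x, ⟪timeDerivWithin (Ioo 0 T) v t x, φ x⟫ := rfl
  rw [← hG₁t, ← hHG, eH]
  ring

end Localisation





/-! ### Smooth mild solutions are classical -/

section Classical

variable {ν T : ℝ}

/-- **Smooth mild solutions are classical** (the content of the named fact
`classical_of_smooth_isMildNSSolutionOn`): a jointly smooth field on `(0, T) × E` with slices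
uniformly essentially bounded on every `(0, T₁)`, `T₁ < T`, which is a mild solution on `(0, T)`
in the duality form from a measurable datum integrable against Gaussians, is — for a suitable
smooth pressure — a classical solution of the unforced Navier–Stokes system on `(0, T)`
(Fabes–Jones–Rivière 1972, Thm. 2.1; weak form by `integral_slab_eq_zero_of_isMildNSSolutionOn_datum`
applied to the field modified at the single time `0`, projected equation by
`integral_inner_momentum_eq_zero_of_slab_weak`, pressure by
`exists_isClassicalNSSolutionOn_of_forall_integral_inner_eq_zero`). [cite: FabesJonesRiviere1972, Thm. 2.1] -/
theorem exists_isClassicalNSSolutionOn_of_smooth_isMildNSSolutionOn (hν : 0 < ν) (hT : 0 < T)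
    {u₀ : E → E} {v : ℝ → E → E} (hu₀m : AEStronglyMeasurable u₀ volume)
    (hu₀G : ∀ a : ℝ, 0 < a → Integrable (fun y => UnboundedOperators.heatKernel a y * ‖u₀ y‖) volume)
    (hv : IsSmoothSpaceTimeOn (Ioo 0 T) v)
    (hbd : ∀ T₁ ∈ Ioo 0 T, ∃ C : ℝ≥0∞, C < ∞ ∧ ∀ t ∈ Ioo 0 T₁, eLpNorm (v t) ∞ volume ≤ C)
    (hmild : IsMildNSSolutionOn (Ioo 0 T) ν 0 u₀ v) :
    ∃ p : ℝ → E → ℝ, IsClassicalNSSolutionOn (Ioo 0 T) ν 0 v p := by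
  have hdivv : ∀ t ∈ Ioo 0 T, VectorCalculus.IsDivFree (v t) := fun t ht =>
    (hmild.1 t ht).isDivFree_of_contDiff (contDiff_infty.1 (hv.contDiff_slice ht) 1)
  -- the field modified at time `0` (where `v` is arbitrary)
  set w : ℝ → E → E := Function.update v 0 0 with hw
  have hw_eq : ∀ t, t ≠ 0 → w t = v t := fun t ht => Function.update_of_ne ht _ _
  have hw0 : w 0 = 0 := Function.update_self _ _ _
  have hmildw : IsMildNSSolutionOn (Ioo 0 T) ν 0 u₀ w := by
    refine ⟨fun t ht => ?_, fun t ht φ hφ hdiv => ?_⟩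
    · rw [hw_eq t ht.1.ne']
      exact hmild.1 t ht
    · have key := hmild.2 t ht φ hφ hdiv
      rw [hw_eq t ht.1.ne']
      have e : (∫ τ in (0 : ℝ)..t, ∫ x, ⟪w τ x, convect (w τ) (heatTest ν φ (t - τ)) x⟫) =
          ∫ τ in (0 : ℝ)..t, ∫ x, ⟪v τ x, convect (v τ) (heatTest ν φ (t - τ)) x⟫ := by
        refine intervalIntegral.integral_congr_ae ?_
        have h0 : ∀ᵐ τ ∂(volume : Measure ℝ), τ ≠ 0 := by
          rw [ae_iff]
          simp
        filter_upwards [h0] with τ hτ _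
        rw [hw_eq τ hτ]
      rw [e]
      exact key
  -- pointwise bounds on closed slabs `[0, b]`, `b < T`
  have hM : ∀ b < T, ∃ M : ℝ, ∀ t ∈ Icc 0 b, ∀ x, ‖w t x‖ ≤ M := by
    intro b hb
    by_cases hb0 : b < 0
    · exact ⟨0, fun t ht => absurd (ht.1.trans ht.2) (not_le.2 hb0)⟩
    replace hb0 : 0 ≤ b := not_lt.1 hb0
    obtain ⟨C, hC, hCb⟩ := hbd ((b + T) / 2) ⟨by linarith, by linarith⟩
    refine ⟨C.toReal, fun t ht x => ?_⟩
    rcases ht.1.eq_or_lt with h0 | hpos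
    · rw [← h0, hw0]
      simp
    · rw [hw_eq t hpos.ne']
      exact norm_le_of_eLpNorm_top_le_of_continuous (hv.contDiff_slice ⟨hpos, by linarith [ht.2]⟩).continuous
        hC.ne (hCb t ⟨hpos, by linarith [ht.2]⟩) x
  have hsl : ∀ t ∈ Ico 0 T, AEStronglyMeasurable (w t) volume := by
    intro t ht
    rcases ht.1.eq_or_lt with h0 | hpos
    · rw [← h0, hw0]
      exact aestronglyMeasurable_const
    · rw [hw_eq t hpos.ne']
      exact (hv.contDiff_slice ⟨hpos, ht.2⟩).continuous.aestronglyMeasurable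
  have hmeas : AEStronglyMeasurable (uncurry w) ((volume : Measure (ℝ × E)).restrict (Ioo 0 T ×ˢ univ)) := by
    have h1 : AEStronglyMeasurable (uncurry v) ((volume : Measure (ℝ × E)).restrict (Ioo 0 T ×ˢ univ)) :=
      hv.continuousOn.aestronglyMeasurable (measurableSet_Ioo.prod MeasurableSet.univ)
    refine h1.congr ?_
    filter_upwards [ae_restrict_mem (measurableSet_Ioo.prod MeasurableSet.univ)] with q hq
    simp only [uncurry]
    rw [hw_eq q.1 (mem_prod.1 hq).1.1.ne']
  -- the weak form for `w`, hence for `v`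
  have hweak : ∀ ψ : ℝ → E → E, IsSpaceTimeTestOn (slab E (Ioo 0 T) isOpen_Ioo) ψ →
      (∀ t, VectorCalculus.IsDivFree (ψ t)) →
      ∫ t in Ioo 0 T, ∫ x, (⟪v t x, timeDeriv ψ t x⟫ + ⟪v t x, convect (v t) (ψ t) x⟫ +
        ν * ⟪v t x, Δ (ψ t) x⟫) = 0 := by
    intro ψ hψ hψd
    have h := integral_slab_eq_zero_of_isMildNSSolutionOn_datum hν hT hu₀m hu₀G hmildw hM hsl hmeas hψ hψd
    refine (setIntegral_congr_fun measurableSet_Ioo fun t ht => ?_).trans h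
    rw [hw_eq t ht.1.ne']
  have hf0 : IsSmoothSpaceTimeOn (Ioo 0 T) (0 : ℝ → E → E) := contDiffOn_const
  exact exists_isClassicalNSSolutionOn_of_forall_integral_inner_eq_zero isOpen_Ioo hv hf0 hdivv
    fun t ht φ hφ hφd => integral_inner_momentum_eq_zero_of_slab_weak hv hdivv hweak ht hφ hφd

variable (E) in
/-- **Discharge of the named fact (C)** `classical_of_smooth_isMildNSSolutionOn` of
`NSBoundedMildOseen.lean` (smooth mild solutions are classical; Fabes–Jones–Rivière 1972,
Thm. 2.1), by `exists_isClassicalNSSolutionOn_of_smooth_isMildNSSolutionOn`. [cite: FabesJonesRiviere1972, Thm. 2.1] -/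
theorem classical_of_smooth_isMildNSSolutionOn_holds : classical_of_smooth_isMildNSSolutionOn E :=
  fun _ν _T hν hT _u₀ _v hu₀m hu₀G hv hbd hmild =>
    exists_isClassicalNSSolutionOn_of_smooth_isMildNSSolutionOn hν hT hu₀m hu₀G hv hbd hmild

end Classical

end Literature.Analysis.FluidPDE

end
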